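import Summits.ResolutionOfSingularities.ResolutionOfSingularities.Theorems.EquisingularLiftEquisingularLiftReducedStrictTransformBlowup
import Literature.AlgebraicGeometry.Resolution.Blowups
import Literature.AlgebraicGeometry.Resolution.BlowupsProperProofs
import Literature.AlgebraicGeometry.Resolution.NonPrincipalLocus
import Literature.AlgebraicGeometry.Resolution.StalkIdealLemmas
import Literature.AlgebraicGeometry.Resolution.AlterationsSectionDivisor
import Summits.ResolutionOfSingularities.ResolutionOfSingularities.Theorems.EquisingularLiftEquisingularLiftNatStrictTransformClosureCompl
import HarnessLib

/-!
# [OURS · L1 W4.5(b) · EL♮] T-TRACE-ISO: a centre with PRINCIPAL TRACE on the reduced strict transform does not change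
# its local ring — the (non-)regularity of the point SURVIVES the blow-up (any scheme, any `n`)
# (crux `EquisingularLiftNat` = stmt-ResolutionOfSingularities-20038; K-∀n / K5-BMY necessity lane, kill test #50)

HONEST FRAMING. OURS (cell res-hironaka, crux chain w45b, slot W4.5(b)); NOT a statement of any manuscript; replaces the role
of NOTHING in the manuscript; AI-written, AI review is weaker than expert review. Helper `--supports
stmt-ResolutionOfSingularities-20038 --as helper`.

WHY. The by-hand K5-BMY analysis (res-L1-w45b-strat-1 STRATEGY-CENSUS v3 §2 «inertia of fat touches»; res-D-brk-4 K5-BMY NOTE)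
kills the branch «fat touch» in two halves: (ring half, IN THE KERNEL: `…AnisoInertia.exists_map_span_pair_eq_span_singleton`,
p515200) under anisotropy the TRACE IDEAL `C·𝒪_{V(S),w}` of the centre on the `H`-germ is PRINCIPAL; (scheme half, THIS FILE)
a blow-up whose centre has non-zero principal trace on the reduced closed subscheme `V(S)` at `w` is, ON THE REDUCED STRICT
TRANSFORM, an ISOMORPHISM over a neighbourhood of `w`: there is a point `w₂` of `V(closure τ⁻¹(S ∖ supp C))` over `w` with
isomorphic local ring, so `w₂` is regular iff `w` is. Combined with T-USEFUL-TOUCH (p513560: the LAST touch over `x` leaves every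
point over `x` regular) this says: THE FINISHING TOUCH HAS NON-PRINCIPAL TRACE.

* `isEffectiveCartier_comap_ι_of_ideal_eq_span` — one affine chart `V` with `J(V) = (g)`, `g` a non-zero-divisor ⇒ `J|_V` is an
  effective Cartier divisor;
* `exists_isIso_morphismRestrict_of_stalkIdeal_eq_span` — `Z` integral locally Noetherian, `ρ : Z′ → Z` a blow-up along `J`,
  `J_w = (f)` with `f ≠ 0` ⇒ `ρ` is an isomorphism over an open `U ∋ w` (spread the generator, GW I rem. after Def. 13.90);
* `exists_over_isIso_stalkMap_of_principal_trace` — THE OBJECT: `τ : X′ → X` a blow-up along `C` (`X` locally Noetherian),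
  `S ⊆ X` closed irreducible, `¬ S ⊆ supp C`, `w ∈ V(S)` with `(C·𝒪_{V(S)})_w = (f)`, `f ≠ 0` ⇒ the reduced strict transform
  `V(closure τ⁻¹(S ∖ supp C)) → V(S)` (a blow-up along `C·𝒪_{V(S)}`, Stacks 080E, tree `exists_isBlowup_reducedStrictTransform`)
  has a point `w₂` over `w` with invertible stalk map; `…_isRegularLocalRing_iff…` — hence `𝒪_{w₂}` regular iff `𝒪_w` regular;
* `map_stalkMap_eq_stalkIdeal_comap`, `isPrincipal_trace_of_isPrincipal_map_mk` — RING BRIDGE to the AnisoInertia currency: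
  with `R := 𝒪_{X, ι w}`, `P := ker (R → 𝒪_{V(S), w}) = (I_S)_{ι w}`, the trace `(C·𝒪_{V(S)})_w` is the image of `C_{ι w}`, and
  «`(C_{ι w}).map (mk P)` principal» ⇒ «trace principal» (and non-zero iff `C_{ι w} ⊄ P`).

References: GW I Def. 13.90 + remark, Prop. 13.91 [GortzWedhorn2020]; Stacks 080E; tree `Literature…Blowups` (`IsBlowup.restrict`,
`IsBlowup.isIso`), `…NonPrincipalLocus` (`isLocallyPrincipalAt_of_isPrincipal_stalkIdeal`), `…StalkIdealLemmas`
(`stalkIdeal_comap_eq_map_stalkMap`), `…AlterationsSectionDivisor` (`stalkIdeal_ker_eq_ker_stalkMap`),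
`Summits…ReducedStrictTransformBlowup` (`exists_isBlowup_reducedStrictTransform`).
-/

set_option linter.dupNamespace false -- mandated namespace `Summit.<Summit>.<Problem>` of this single-conjunct summit

universe u

open CategoryTheory AlgebraicGeometry TopologicalSpace Topology
open Literature.AlgebraicGeometry.Resolution
open AlgebraicGeometry.Scheme.IdealSheafData
open Summit.ResolutionOfSingularities.ResolutionOfSingularities.Cruxes.EquisingularLift.StrataSplit

namespace Summit.ResolutionOfSingularities.ResolutionOfSingularities.Cruxes.EquisingularLiftNat.Sections

/-! ## One principal chart with a regular generator is an effective Cartier divisor -/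

/-- **One chart suffices.** If on the affine open `V` the ideal `J(V)` is generated by a single non-zero-divisor `g`, then the
restriction `J|_V` (the pulled-back ideal sheaf along `V ↪ Z`) is an effective Cartier divisor: every point of `V` has the
affine neighbourhoods `V.ι(W) ⊆ V`, on which `J` is generated by the (still regular) restriction of `g`. [folklore; GW I (13.19)] -/
theorem isEffectiveCartier_comap_ι_of_ideal_eq_span {Z : Scheme.{u}} {J : Z.IdealSheafData} {V : Z.affineOpens}
    {g : Γ(Z, V)} (hg : g ∈ nonZeroDivisors Γ(Z, V)) (hJ : J.ideal V = Ideal.span {g}) :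
    IsEffectiveCartier (J.comap (V : Z.Opens).ι) := by
  intro u
  obtain ⟨W, hW, huW, -⟩ :=
    exists_isAffineOpen_mem_and_subset (X := (V : Z.Opens)) (x := u) (U := ⊤) (Opens.mem_top u)
  have hB : IsAffineOpen ((V : Z.Opens).ι ''ᵁ W) := hW.image_of_isOpenImmersion (V : Z.Opens).ι
  have hBV : (V : Z.Opens).ι ''ᵁ W ≤ (V : Z.Opens) := by
    rintro x ⟨w, -, rfl⟩
    exact w.2
  set g' : Γ(Z, (V : Z.Opens).ι ''ᵁ W) := Z.presheaf.map (homOfLE hBV).op g with hg'def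
  have hg' : g' ∈ nonZeroDivisors Γ(Z, (V : Z.Opens).ι ''ᵁ W) :=
    map_mem_nonZeroDivisors_of_le (U := ⟨_, hB⟩) (V := V) hBV hg
  have hIB : J.ideal ⟨(V : Z.Opens).ι ''ᵁ W, hB⟩ = Ideal.span {g'} := by
    rw [← J.map_ideal (U := ⟨_, hB⟩) (V := V) hBV, hJ, Ideal.map_span, Set.image_singleton]
    rfl
  -- the sections of `V` over `W` are those of `Z` over `V.ι '' W`
  let e := (V : Z.Opens).ι.appIso W
  refine ⟨⟨W, hW⟩, huW, e.hom.hom g', ?_, ?_⟩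
  · rw [mem_nonZeroDivisors_iff_right]
    intro x hx
    have hx' : e.inv.hom x * g' = 0 := by
      have := congrArg e.inv.hom hx
      rwa [map_mul, map_zero, ← CommRingCat.comp_apply, e.hom_inv_id] at this
    have := (mem_nonZeroDivisors_iff_right.mp hg') _ hx'
    calc x = e.hom.hom (e.inv.hom x) := by rw [← CommRingCat.comp_apply, e.inv_hom_id]; rfl
      _ = 0 := by rw [this, map_zero]
  · rw [Scheme.IdealSheafData.ideal_comap_of_isOpenImmersion]
    change (J.ideal ⟨(V : Z.Opens).ι ''ᵁ W, hB⟩).comap e.inv.hom = _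
    rw [hIB]
    apply le_antisymm
    · intro x hx
      rw [Ideal.mem_comap, Ideal.mem_span_singleton] at hx
      obtain ⟨a, ha⟩ := hx
      rw [Ideal.mem_span_singleton]
      refine ⟨e.hom.hom a, ?_⟩
      calc x = e.hom.hom (e.inv.hom x) := by rw [← CommRingCat.comp_apply, e.inv_hom_id]; rfl
        _ = e.hom.hom g' * e.hom.hom a := by rw [ha, map_mul]
    · rw [Ideal.span_singleton_le_iff_mem, Ideal.mem_comap, ← CommRingCat.comp_apply, e.hom_inv_id]
      exact Ideal.mem_span_singleton_self g'

/-! ## A blow-up is an isomorphism near a point where the centre has a non-zero principal stalk -/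

/-- **Spreading a principal stalk: the blow-up is an isomorphism near `w`.** Let `Z` be an integral locally Noetherian scheme,
`ρ : Z′ → Z` a blow-up of `Z` along `J`, and `w ∈ Z` a point at which the stalk `J_w = J·𝒪_{Z,w}` is generated by ONE non-zero
element. Then `ρ` restricts to an isomorphism `ρ⁻¹U ≅ U` over some open `U ∋ w`: the generator spreads to an affine
neighbourhood `V` with `J(V) = (g)` (`isLocallyPrincipalAt_of_isPrincipal_stalkIdeal`), `g ≠ 0` is regular in the domain
`Γ(Z, V)`, so `J|_V` is an effective Cartier divisor and the restricted blow-up `ρ ∣_ V` (GW I Prop. 13.91) is an isomorphism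
(GW I, remark after Def. 13.90). [cite: GortzWedhorn2020, Def. 13.90 + Prop. 13.91] -/
theorem exists_isIso_morphismRestrict_of_stalkIdeal_eq_span {Z Z' : Scheme.{u}} [IsIntegral Z] [IsLocallyNoetherian Z]
    {ρ : Z' ⟶ Z} {J : Z.IdealSheafData} (hρ : IsBlowup ρ J) {w : Z} {f : Z.presheaf.stalk w}
    (hf : stalkIdeal J w = Ideal.span {f}) (hf0 : f ≠ 0) :
    ∃ U : Z.Opens, w ∈ U ∧ IsIso (ρ ∣_ U) := by
  obtain ⟨V, hwV, g, hJV⟩ := isLocallyPrincipalAt_of_isPrincipal_stalkIdeal (J := J) (x := w) ⟨f, hf⟩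
  -- `g ≠ 0`: its germ generates `J_w = (f) ≠ 0`
  have hg0 : g ≠ 0 := by
    rintro rfl
    apply hf0
    have h := stalkIdeal_eq_map_germ J V hwV
    rw [hJV, Ideal.map_span, Set.image_singleton, map_zero, Ideal.span_singleton_zero, hf,
      Ideal.span_singleton_eq_bot] at h
    exact h
  haveI : Nonempty ((V : Z.Opens) : Set Z) := ⟨⟨w, hwV⟩⟩
  haveI : Nonempty (V : Z.Opens) := ⟨⟨w, hwV⟩⟩
  have hg : g ∈ nonZeroDivisors Γ(Z, V) := mem_nonZeroDivisors_of_ne_zero hg0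
  exact ⟨V, hwV, (hρ.restrict (V : Z.Opens)).isIso (isEffectiveCartier_comap_ι_of_ideal_eq_span hg hJV)⟩

/-- **Local rings are unchanged over the neighbourhood** (Mathlib `morphismRestrictStalkMap`): if `ρ ∣_ U` is an isomorphism,
the stalk map `𝒪_{Z, ρ z} → 𝒪_{Z′, z}` is an isomorphism at every `z` over `U`. [folklore] -/
theorem isIso_stalkMap_of_isIso_morphismRestrict' {Z Z' : Scheme.{u}} (ρ : Z' ⟶ Z) (U : Z.Opens)
    (hiso : IsIso (ρ ∣_ U)) {z : Z'} (hz : ρ z ∈ U) : IsIso (ρ.stalkMap z) := by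
  have h1 : IsIso ((ρ ∣_ U).stalkMap ⟨z, hz⟩) := inferInstance
  exact ((MorphismProperty.isomorphisms CommRingCat).arrow_mk_iso_iff
    (morphismRestrictStalkMap ρ U ⟨z, hz⟩)).mp h1

/-! ## THE OBJECT: principal trace ⇒ a point of the reduced strict transform over `w` with isomorphic local ring -/

/-- **[OURS · L1 W4.5(b)] T-TRACE-ISO.** Let `X` be locally Noetherian, `τ : X′ → X` a blow-up of `X` along the ideal sheaf `C`,
`S ⊆ X` closed and irreducible with `S ⊄ supp C`, and `w` a point of the reduced closed subscheme `V(S)` at which the TRACE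
`(C·𝒪_{V(S)})_w` of the centre is generated by ONE NON-ZERO element. Then the reduced strict transform
`V(closure τ⁻¹(S ∖ supp C)) → V(S)` — a proper morphism `ρ` over `τ` which is a blow-up of `V(S)` along `C·𝒪_{V(S)}` (Stacks 080E;
tree `exists_isBlowup_reducedStrictTransform`) — is an isomorphism over a neighbourhood of `w`; in particular there is a point
`w₂` of the reduced strict transform with `ρ w₂ = w` (so `τ w₂ = w` in `X`) and INVERTIBLE stalk map `𝒪_{V(S),w} → 𝒪_{w₂}`.
[cite: StacksProject, Tag 080E; GortzWedhorn2020, Prop. 13.91] -/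
theorem exists_over_isIso_stalkMap_of_principal_trace {X X' : AlgebraicGeometry.Scheme.{0}} [AlgebraicGeometry.IsLocallyNoetherian X]
    (τ : X' ⟶ X) (C : X.IdealSheafData) (hτ : Literature.AlgebraicGeometry.Resolution.IsBlowup τ C)
    (S : Set X) (hS : IsClosed S) (hirr : IsIrreducible S) (hSC : ¬ S ⊆ (C.support : Set X))
    (w : ↥(AlgebraicGeometry.Scheme.IdealSheafData.vanishingIdeal (⟨S, hS⟩ : TopologicalSpace.Closeds X)).subscheme)
    {f : (AlgebraicGeometry.Scheme.IdealSheafData.vanishingIdeal (⟨S, hS⟩ : TopologicalSpace.Closeds X)).subscheme.presheaf.stalk w}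
    (hf : stalkIdeal (C.comap (AlgebraicGeometry.Scheme.IdealSheafData.vanishingIdeal (⟨S, hS⟩ : TopologicalSpace.Closeds X)).subschemeι) w = Ideal.span {f})
    (hf0 : f ≠ 0) :
    ∃ ρ : (AlgebraicGeometry.Scheme.IdealSheafData.vanishingIdeal (⟨closure (τ ⁻¹' (S \ (C.support : Set X))), isClosed_closure⟩ : TopologicalSpace.Closeds X')).subscheme ⟶ (AlgebraicGeometry.Scheme.IdealSheafData.vanishingIdeal (⟨S, hS⟩ : TopologicalSpace.Closeds X)).subscheme,
      CategoryTheory.CategoryStruct.comp ρ (AlgebraicGeometry.Scheme.IdealSheafData.vanishingIdeal (⟨S, hS⟩ : TopologicalSpace.Closeds X)).subschemeι = CategoryTheory.CategoryStruct.comp (AlgebraicGeometry.Scheme.IdealSheafData.vanishingIdeal (⟨closure (τ ⁻¹' (S \ (C.support : Set X))), isClosed_closure⟩ : TopologicalSpace.Closeds X')).subschemeι τ ∧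
      ∃ w₂ : ↥(AlgebraicGeometry.Scheme.IdealSheafData.vanishingIdeal (⟨closure (τ ⁻¹' (S \ (C.support : Set X))), isClosed_closure⟩ : TopologicalSpace.Closeds X')).subscheme,
        ρ w₂ = w ∧
        τ ((AlgebraicGeometry.Scheme.IdealSheafData.vanishingIdeal (⟨closure (τ ⁻¹' (S \ (C.support : Set X))), isClosed_closure⟩ : TopologicalSpace.Closeds X')).subschemeι w₂) = (AlgebraicGeometry.Scheme.IdealSheafData.vanishingIdeal (⟨S, hS⟩ : TopologicalSpace.Closeds X)).subschemeι w ∧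
        CategoryTheory.IsIso (ρ.stalkMap w₂) := by
  haveI : IsProper τ := hτ.isProper
  haveI : IsLocallyNoetherian X' := LocallyOfFiniteType.isLocallyNoetherian τ
  obtain ⟨ρ, hρτ, -, hρ⟩ := exists_isBlowup_reducedStrictTransform X X' τ C hτ S hS hirr hSC
  haveI : IsIntegral (vanishingIdeal (⟨S, hS⟩ : Closeds X)).subscheme :=
    ComponentGluing.isIntegral_subscheme_vanishingIdeal ⟨S, hS⟩ hirr
  haveI : IsLocallyNoetherian (vanishingIdeal (⟨S, hS⟩ : Closeds X)).subscheme :=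
    LocallyOfFiniteType.isLocallyNoetherian (vanishingIdeal (⟨S, hS⟩ : Closeds X)).subschemeι
  obtain ⟨U, hwU, hiso⟩ := exists_isIso_morphismRestrict_of_stalkIdeal_eq_span hρ hf hf0
  -- a point of the strict transform over `w`
  obtain ⟨z, hz⟩ := (ρ ∣_ U).surjective ⟨w, hwU⟩
  have hρz : ρ z.1 = w := by
    have h := morphismRestrict_base_coe ρ U z
    rw [hz] at h
    exact h.symm
  refine ⟨ρ, hρτ, z.1, hρz, ?_, ?_⟩
  · have h := congrArg (fun φ => φ z.1) hρτ
    simp only [Scheme.Hom.comp_apply] at h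
    rw [← h, hρz]
  · exact isIso_stalkMap_of_isIso_morphismRestrict' ρ U hiso (by rw [hρz]; exact hwU)

/-- **Corollary: the (non-)regularity of the point SURVIVES a blow-up with principal trace.** In the setting of
`exists_over_isIso_stalkMap_of_principal_trace` there is a point `w₂` of the reduced strict transform, over `w` in `X`, whose
local ring is regular iff `𝒪_{V(S), w}` is. [folklore] -/
theorem exists_over_isRegularLocalRing_iff_of_principal_trace {X X' : AlgebraicGeometry.Scheme.{0}} [AlgebraicGeometry.IsLocallyNoetherian X]
    (τ : X' ⟶ X) (C : X.IdealSheafData) (hτ : Literature.AlgebraicGeometry.Resolution.IsBlowup τ C)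
    (S : Set X) (hS : IsClosed S) (hirr : IsIrreducible S) (hSC : ¬ S ⊆ (C.support : Set X))
    (w : ↥(AlgebraicGeometry.Scheme.IdealSheafData.vanishingIdeal (⟨S, hS⟩ : TopologicalSpace.Closeds X)).subscheme)
    {f : (AlgebraicGeometry.Scheme.IdealSheafData.vanishingIdeal (⟨S, hS⟩ : TopologicalSpace.Closeds X)).subscheme.presheaf.stalk w}
    (hf : stalkIdeal (C.comap (AlgebraicGeometry.Scheme.IdealSheafData.vanishingIdeal (⟨S, hS⟩ : TopologicalSpace.Closeds X)).subschemeι) w = Ideal.span {f})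
    (hf0 : f ≠ 0) :
    ∃ w₂ : ↥(AlgebraicGeometry.Scheme.IdealSheafData.vanishingIdeal (⟨closure (τ ⁻¹' (S \ (C.support : Set X))), isClosed_closure⟩ : TopologicalSpace.Closeds X')).subscheme,
      τ ((AlgebraicGeometry.Scheme.IdealSheafData.vanishingIdeal (⟨closure (τ ⁻¹' (S \ (C.support : Set X))), isClosed_closure⟩ : TopologicalSpace.Closeds X')).subschemeι w₂) = (AlgebraicGeometry.Scheme.IdealSheafData.vanishingIdeal (⟨S, hS⟩ : TopologicalSpace.Closeds X)).subschemeι w ∧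
      (IsRegularLocalRing ((AlgebraicGeometry.Scheme.IdealSheafData.vanishingIdeal (⟨closure (τ ⁻¹' (S \ (C.support : Set X))), isClosed_closure⟩ : TopologicalSpace.Closeds X')).subscheme.presheaf.stalk w₂) ↔
        IsRegularLocalRing ((AlgebraicGeometry.Scheme.IdealSheafData.vanishingIdeal (⟨S, hS⟩ : TopologicalSpace.Closeds X)).subscheme.presheaf.stalk w)) := by
  obtain ⟨ρ, -, w₂, hρw, hτw, hiso⟩ := exists_over_isIso_stalkMap_of_principal_trace τ C hτ S hS hirr hSC w hf hf0
  refine ⟨w₂, hτw, ?_⟩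
  subst hρw
  let e := (asIso (ρ.stalkMap w₂)).commRingCatIsoToRingEquiv
  exact ⟨fun h => IsRegularLocalRing.of_ringEquiv e.symm, fun h => IsRegularLocalRing.of_ringEquiv e⟩

/-! ## A zero trace forces the whole subscheme into the centre -/

/-- **A zero stalk forces full support.** On an integral scheme, if the stalk `J_w` of an ideal sheaf vanishes at ONE point
then `supp J` is everything: germs of sections over an affine `V ∋ w` are zero, hence the sections are (`germ` is injective on
integral schemes), so `V ⊆ supp J`, and `V` is dense. [folklore] -/
theorem support_eq_top_of_stalkIdeal_eq_bot {Z : Scheme.{u}} [IsIntegral Z] (J : Z.IdealSheafData) {w : Z}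
    (h : stalkIdeal J w = ⊥) : (J.support : Set Z) = Set.univ := by
  obtain ⟨V, hV, hwV, -⟩ :=
    exists_isAffineOpen_mem_and_subset (X := Z) (x := w) (U := ⊤) (Opens.mem_top w)
  have hJV : J.ideal ⟨V, hV⟩ = ⊥ := by
    rw [stalkIdeal_eq_map_germ J ⟨V, hV⟩ hwV] at h
    rw [eq_bot_iff]
    intro s hs
    have h0 : (Z.presheaf.germ V w hwV).hom s = 0 := by
      have := Ideal.mem_map_of_mem (Z.presheaf.germ V w hwV).hom hs
      rw [h] at this
      exact this
    exact germ_injective_of_isIntegral (X := Z) w hwV (by rw [h0, map_zero])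
  have hVJ : (V : Set Z) ⊆ J.support := by
    intro v hv
    rw [SetLike.mem_coe, mem_support_iff_of_mem (I := J) (U := ⟨V, hV⟩) hv, hJV, Scheme.mem_zeroLocus_iff]
    intro f hf
    have hf0 : f = 0 := by simpa using hf
    subst hf0
    simp
  have hdense : Dense (V : Set Z) := V.2.dense ⟨w, hwV⟩
  exact Set.eq_univ_of_univ_subset (hdense.closure_eq ▸ closure_minimal hVJ J.support.isClosed)

/-! ## RING BRIDGE: the trace is the image of the centre's stalk in `𝒪_{X,x} ⧸ P` -/

/-- **The trace is the extended stalk.** For any morphism `ι : Z → X` and `w ∈ Z`, the stalk of the pulled-back ideal sheaf is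
the image of the stalk: `(C·𝒪_Z)_w = C_{ι w} · 𝒪_{Z,w}` (tree `stalkIdeal_comap_eq_map_stalkMap`, restated). [folklore] -/
theorem stalkIdeal_comap_eq_map {Z X : Scheme.{u}} (ι : Z ⟶ X) (C : X.IdealSheafData) (w : Z) :
    stalkIdeal (C.comap ι) w = (stalkIdeal C (ι w)).map (ι.stalkMap w).hom :=
  stalkIdeal_comap_eq_map_stalkMap ι C w

/-- **Ring bridge to the `R ⧸ P` currency** (as in `…AnisoInertia.exists_map_span_pair_eq_span_singleton`, p515200). For a
CLOSED IMMERSION `ι : Z → X` and `w ∈ Z`, put `R := 𝒪_{X, ι w}`, `φ := ι_w^♯ : R → 𝒪_{Z,w}` (surjective) and `P := ker φ`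
(`= (ker ι)_{ι w}`, tree `stalkIdeal_ker_eq_ker_stalkMap`). If the image of `C_{ι w}` in `R ⧸ P` is principal, so is the trace
`(C·𝒪_Z)_w`. [folklore] -/
theorem isPrincipal_stalkIdeal_comap_of_map_mk {Z X : Scheme.{u}} (ι : Z ⟶ X) [IsClosedImmersion ι]
    (C : X.IdealSheafData) (w : Z)
    (h : ((stalkIdeal C (ι w)).map (Ideal.Quotient.mk (RingHom.ker (ι.stalkMap w).hom))).IsPrincipal) :
    (stalkIdeal (C.comap ι) w).IsPrincipal := by
  have hsurj : Function.Surjective (ι.stalkMap w).hom := ι.stalkMap_surjective w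
  let e := RingHom.quotientKerEquivOfSurjective hsurj
  have hφ : (ι.stalkMap w).hom = e.toRingHom.comp (Ideal.Quotient.mk (RingHom.ker (ι.stalkMap w).hom)) := by
    ext r
    simp [e, RingHom.quotientKerEquivOfSurjective_apply_mk]
  obtain ⟨c, hc⟩ := h
  replace hc : (stalkIdeal C (ι w)).map (Ideal.Quotient.mk (RingHom.ker (ι.stalkMap w).hom)) = Ideal.span {c} := hc
  refine ⟨e c, ?_⟩
  change stalkIdeal (C.comap ι) w = Ideal.span {e c}
  rw [stalkIdeal_comap_eq_map]
  calc (stalkIdeal C (ι w)).map (ι.stalkMap w).hom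
      = ((stalkIdeal C (ι w)).map (Ideal.Quotient.mk (RingHom.ker (ι.stalkMap w).hom))).map e.toRingHom := by
        rw [Ideal.map_map, ← hφ]
    _ = Ideal.span {e c} := by
        rw [hc, Ideal.map_span, Set.image_singleton]
        rfl

/-- Converse bookkeeping: if the trace `(C·𝒪_Z)_w` is principal then so is the image of `C_{ι w}` in `R ⧸ P` (the two are
matched by `R ⧸ P ≅ 𝒪_{Z,w}`). [folklore] -/
theorem isPrincipal_map_mk_of_isPrincipal_stalkIdeal_comap {Z X : Scheme.{u}} (ι : Z ⟶ X) [IsClosedImmersion ι]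
    (C : X.IdealSheafData) (w : Z) (h : (stalkIdeal (C.comap ι) w).IsPrincipal) :
    ((stalkIdeal C (ι w)).map (Ideal.Quotient.mk (RingHom.ker (ι.stalkMap w).hom))).IsPrincipal := by
  have hsurj : Function.Surjective (ι.stalkMap w).hom := ι.stalkMap_surjective w
  let e := RingHom.quotientKerEquivOfSurjective hsurj
  have hmk : Ideal.Quotient.mk (RingHom.ker (ι.stalkMap w).hom) = e.symm.toRingHom.comp (ι.stalkMap w).hom := by
    ext r
    simp [e, RingHom.quotientKerEquivOfSurjective_symm_apply]
  obtain ⟨c, hc⟩ := h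
  replace hc : stalkIdeal (C.comap ι) w = Ideal.span {c} := hc
  refine ⟨e.symm c, ?_⟩
  change Ideal.map _ _ = Ideal.span {e.symm c}
  calc (stalkIdeal C (ι w)).map (Ideal.Quotient.mk (RingHom.ker (ι.stalkMap w).hom))
      = ((stalkIdeal C (ι w)).map (ι.stalkMap w).hom).map e.symm.toRingHom := by
        rw [Ideal.map_map, ← hmk]
    _ = Ideal.span {e.symm c} := by
        rw [← stalkIdeal_comap_eq_map, hc, Ideal.map_span, Set.image_singleton]
        rfl

/-! ## GLUE WITH T-USEFUL-TOUCH: the finishing touch has NON-PRINCIPAL trace -/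

/-- **[OURS · L1 W4.5(b)] The finishing touch has non-principal trace.** One blow-up step `τ : X₂ → X₁` along `C` (`X₁` locally
Noetherian), a set `Y₁ ⊆ X₁` with `closure Y₁` irreducible and not inside `supp C`, a map `σ₁ : X₁ → P` and a point `x ∈ P`;
`w` a point of the reduced `V(closure Y₁)` over `x` whose local ring is NOT regular, while after the step EVERY point of the
reduced strict transform `V(closure (closure τ⁻¹(Y₁ ∖ supp C)))` over `x` is regular (the conclusion of T-USEFUL-TOUCH,
`exists_useful_touch_of_natChain` / `usefulTouch_of_equisingularLiftNat`, p513560). Then the trace `(C·𝒪_{V(closure Y₁)})_w` is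
NOT a principal ideal: a zero trace would put `closure Y₁` inside the centre (`support_eq_top_of_stalkIdeal_eq_bot`), a non-zero
principal one would let the non-regular point survive (`exists_over_isRegularLocalRing_iff_of_principal_trace`). With the ring
half `…AnisoInertia.fatTouchInert` (p515200; bridge `isPrincipal_stalkIdeal_comap_of_map_mk`): under its hypotheses a touch is
never the finishing one. [folklore] -/
theorem not_isPrincipal_trace_of_usefulTouch {X₁ X₂ P : AlgebraicGeometry.Scheme.{0}} [AlgebraicGeometry.IsLocallyNoetherian X₁]
    (σ₁ : X₁ ⟶ P) (x : P) (Y₁ : Set X₁) (C : X₁.IdealSheafData) (τ : X₂ ⟶ X₁)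
    (hτ : Literature.AlgebraicGeometry.Resolution.IsBlowup τ C)
    (hirr : IsIrreducible (closure Y₁)) (hYC : ¬ closure Y₁ ⊆ (C.support : Set X₁))
    (w : ↥(AlgebraicGeometry.Scheme.IdealSheafData.vanishingIdeal (⟨closure Y₁, isClosed_closure⟩ : TopologicalSpace.Closeds X₁)).subscheme)
    (hwx : σ₁ ((AlgebraicGeometry.Scheme.IdealSheafData.vanishingIdeal (⟨closure Y₁, isClosed_closure⟩ : TopologicalSpace.Closeds X₁)).subschemeι w) = x)
    (hw : ¬ IsRegularLocalRing ((AlgebraicGeometry.Scheme.IdealSheafData.vanishingIdeal (⟨closure Y₁, isClosed_closure⟩ : TopologicalSpace.Closeds X₁)).subscheme.presheaf.stalk w))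
    (hall : ∀ w' : ↥(AlgebraicGeometry.Scheme.IdealSheafData.vanishingIdeal (⟨closure (closure (τ ⁻¹' (Y₁ \ (C.support : Set X₁)))), isClosed_closure⟩ : TopologicalSpace.Closeds X₂)).subscheme, (CategoryTheory.CategoryStruct.comp τ σ₁) ((AlgebraicGeometry.Scheme.IdealSheafData.vanishingIdeal (⟨closure (closure (τ ⁻¹' (Y₁ \ (C.support : Set X₁)))), isClosed_closure⟩ : TopologicalSpace.Closeds X₂)).subschemeι w') = x → IsRegularLocalRing ((AlgebraicGeometry.Scheme.IdealSheafData.vanishingIdeal (⟨closure (closure (τ ⁻¹' (Y₁ \ (C.support : Set X₁)))), isClosed_closure⟩ : TopologicalSpace.Closeds X₂)).subscheme.presheaf.stalk w')) :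
    ¬ (stalkIdeal (C.comap (AlgebraicGeometry.Scheme.IdealSheafData.vanishingIdeal (⟨closure Y₁, isClosed_closure⟩ : TopologicalSpace.Closeds X₁)).subschemeι) w).IsPrincipal := by
  rintro ⟨f, hf⟩
  change stalkIdeal _ w = Ideal.span {f} at hf
  haveI : IsIntegral (vanishingIdeal (⟨closure Y₁, isClosed_closure⟩ : Closeds X₁)).subscheme :=
    ComponentGluing.isIntegral_subscheme_vanishingIdeal ⟨closure Y₁, isClosed_closure⟩ hirr
  by_cases hf0 : f = 0
  · -- zero trace: `closure Y₁ ⊆ supp C`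
    subst hf0
    rw [Ideal.span_singleton_zero] at hf
    have hsupp := support_eq_top_of_stalkIdeal_eq_bot _ hf
    rw [support_comap, Closeds.coe_preimage, Set.eq_univ_iff_forall] at hsupp
    apply hYC
    intro y hy
    have hy' : y ∈ Set.range (vanishingIdeal (⟨closure Y₁, isClosed_closure⟩ : Closeds X₁)).subschemeι := by
      rw [ComponentGluing.range_subschemeι_vanishingIdeal]; exact hy
    obtain ⟨z, rfl⟩ := hy'
    exact hsupp z
  · -- non-zero principal trace: the non-regular point survives
    obtain ⟨w₂, hτw₂, hiff⟩ :=
      exists_over_isRegularLocalRing_iff_of_principal_trace τ C hτ (closure Y₁) isClosed_closure hirr hYC w hf hf0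
    have E : (⟨closure (closure (τ ⁻¹' (Y₁ \ (C.support : Set X₁)))), isClosed_closure⟩ : Closeds X₂) =
        ⟨closure (τ ⁻¹' (closure Y₁ \ (C.support : Set X₁))), isClosed_closure⟩ :=
      Closeds.ext (show closure (closure (τ ⁻¹' (Y₁ \ (C.support : Set X₁)))) = closure (τ ⁻¹' (closure Y₁ \ (C.support : Set X₁))) by
        rw [closure_closure]; exact closure_preimage_diff_support_eq_of_isBlowup hτ Y₁)
    rw [E] at hall
    refine hw (hiff.mp (hall w₂ ?_))
    rw [Scheme.Hom.comp_apply, hτw₂, hwx]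

end Summit.ResolutionOfSingularities.ResolutionOfSingularities.Cruxes.EquisingularLiftNat.Sections
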